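import Literature.Analysis.FluidPDE.FiniteFourierModeEulerKeyB
import Literature.Analysis.FluidPDE.FiniteFourierModeEulerPlanar
import Literature.Analysis.FluidPDE.FiniteFourierModeEulerVertices
import Literature.Analysis.FluidPDE.FiniteFourierModeEulerTime
import Literature.Analysis.FluidPDE.FiniteFourierModeEulerODE

/-!
# Kishimoto–Yoneda 2022, Theorem 1.4 (weakened form): the proof

The discharge `KishimotoYoneda2022_finiteMode_rigidity_holds` of the named fact of
`FiniteFourierModeEuler` (N. Kishimoto, T. Yoneda, J. Math. Fluid Mech. 24 (2022) 74 =
arXiv:2110.08039, Thm. 1.4), assembled from the support files `FiniteFourierModeEuler*`: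

1. a generic time interval `(c,d) ⊆ I` on which every mode is identically zero or never zero
   (`exists_generic_Ioo`, replacing the real-analyticity argument (1.6)), and the restricted
   solution with support `S₀` (`restrict`);
2. if `S₀` spans `ℝ³` (§4, Thm. 4.1): at each time the farthest vertex is Beltrami
   (`exists_isBV_farthest`, Props. 4.4 (iv)/4.7 via Lemmas 4.5, 4.6 and Gauss–Bonnet), hence all
   modes are Beltrami with one eigenvalue (`forall_isBV`, Props. 4.4, 4.8), hence no pair interacts
   and the solution is stationary on `(c,d)`;
3. if `S₀` lies in a plane (§3, Prop. 3.1): on a finer generic interval the planar theorem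
   `planar_stationary` gives stationarity;
4. local stationarity propagates to `I` by uniqueness for the ODE (1.3)
   (`stationary_of_stationary_on_Ioo`), so `S₀ = S`, and the dichotomy "`S` planar, or `S` on a
   sphere and `u` Beltrami" follows (`IsBV.sq_eq`).

## References

* [KishimotoYoneda2022] N. Kishimoto, T. Yoneda, J. Math. Fluid Mech. 24 (2022) 74 =
  arXiv:2110.08039, Thm. 1.4, §3 Prop. 3.1, §4 Thm. 4.1 and Props. 4.4–4.8.
-/

noncomputable section

open Matrix Finset Complex

namespace Literature.Analysis.FluidPDE

namespace KY

open scoped Classical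

/-- A finite set of vectors all of whose triples are coplanar with the origin lies in a plane
through the origin. [folklore] -/
theorem exists_normal_of_not_spanning {T : Finset (Fin 3 → ℝ)} (h0 : (0 : Fin 3 → ℝ) ∉ T)
    (h : ¬ ∃ a ∈ T, ∃ b ∈ T, ∃ c ∈ T, a ⬝ᵥ (b ⨯₃ c) ≠ 0) :
    ∃ e : Fin 3 → ℝ, e ≠ 0 ∧ ∀ n ∈ T, e ⬝ᵥ n = 0 := by
  push Not at h
  by_cases hT : ∃ a ∈ T, ∃ b ∈ T, a ⨯₃ b ≠ 0
  · obtain ⟨a, ha, b, hb, hab⟩ := hT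
    refine ⟨a ⨯₃ b, hab, fun n hn => ?_⟩
    rw [dotProduct_comm]; exact h n hn a ha b hb
  · push Not at hT
    by_cases hne : T.Nonempty
    · obtain ⟨a, ha⟩ := hne
      have ha0 : a ≠ 0 := fun h0' => h0 (h0' ▸ ha)
      -- a vector `v` with `a × v ≠ 0`
      obtain ⟨v, hv⟩ : ∃ v : Fin 3 → ℝ, a ⨯₃ v ≠ 0 := by
        by_contra hno
        push Not at hno
        have h1 := hno ![1, 0, 0]
        have h2 := hno ![0, 1, 0]
        simp only [cross_apply, Matrix.cons_val_zero, Matrix.cons_val_one, Matrix.head_cons,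
          Matrix.cons_val_two, Matrix.tail_cons, mul_one, mul_zero, sub_zero, zero_sub,
          Matrix.cons_eq_zero_iff, neg_eq_zero, Matrix.zero_empty, and_true, true_and] at h1 h2
        apply ha0; ext i; fin_cases i
        · exact h2.2
        · exact h1.2
        · exact h1.1
      refine ⟨a ⨯₃ v, hv, fun n hn => ?_⟩
      have := eq_smul_of_cross_eq_zero ha0 (u := n) (by rw [← cross_anticomm, hT a ha n hn, neg_zero])
      rw [this, dotProduct_smul, dotProduct_comm (a ⨯₃ v) a, dot_self_cross, smul_zero]
    · refine ⟨![1, 0, 0], by simp, fun n hn => absurd ⟨n, hn⟩ hne⟩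

end KY

open KY

/-- **Kishimoto–Yoneda 2022, Theorem 1.4 (weakened form).** See `FiniteFourierModeEuler` for the
statement and this file's docstring for the architecture of the proof.
[cite: KishimotoYoneda2022, Thm. 1.4 (with §3 Prop. 3.1 and §4 Thm. 4.1, Props. 4.4–4.8)] -/
theorem KishimotoYoneda2022_finiteMode_rigidity_holds : KishimotoYoneda2022_finiteMode_rigidity := by
  intro I S u hS
  -- Step 1: a generic interval and the restricted solution
  obtain ⟨c, d, hcd, hsub, hgen, -⟩ := hS.exists_generic_Ioo (κ := Unit) (E := Fin 3 → ℂ) ∅ (fun _ z => z)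
    (fun _ h => absurd h (Finset.notMem_empty _))
  set t₀ : ℝ := (c + d) / 2 with ht₀def
  have ht₀ : t₀ ∈ Set.Ioo c d := ⟨by rw [ht₀def]; linarith, by rw [ht₀def]; linarith⟩
  obtain ⟨hS₀, hnz, hz⟩ := hS.restrict hcd hsub hgen ht₀
  set S₀ := S.filter fun n => u n t₀ ≠ 0 with hS₀def
  set u₀ : (Fin 3 → ℝ) → ℝ → (Fin 3 → ℂ) := fun n t => if n ∈ S₀ then u n t else 0 with hu₀def
  have hu₀_mem : ∀ n ∈ S₀, ∀ t, u₀ n t = u n t := fun n hn t => by simp only [hu₀def, if_pos hn]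
  have hgen₀ : ∀ n ∈ S₀, ∀ t ∈ Set.Ioo c d, u₀ n t ≠ 0 := fun n hn t ht => by
    rw [hu₀_mem n hn t]; exact hnz n hn t ht
  -- local stationarity of `u₀` gives global stationarity of `u`
  have hglob : (∀ n, ∀ c' d' : ℝ, c' < d' → Set.Ioo c' d' ⊆ Set.Ioo c d →
      (∀ n, ∀ t ∈ Set.Ioo c' d', ∀ s ∈ Set.Ioo c' d', u₀ n t = u₀ n s) →
      ∀ t ∈ I, ∀ s ∈ I, u n t = u n s) := by
    intro n c' d' hcd' hsub' hconst t ht s hs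
    apply hS.stationary_of_stationary_on_Ioo hcd' (hsub'.trans hsub) _ n ht hs
    intro k a ha b hb
    by_cases hk : k ∈ S₀
    · rw [← hu₀_mem k hk a, ← hu₀_mem k hk b]; exact hconst k a ha b hb
    · by_cases hkS : k ∈ S
      · rw [hz k hkS hk a (hsub' ha), hz k hkS hk b (hsub' hb)]
      · rw [hS.eq_zero_of_notMem k hkS, hS.eq_zero_of_notMem k hkS]
  -- from global stationarity: `S₀ = S`
  have hS₀S : (∀ n, ∀ t ∈ I, ∀ s ∈ I, u n t = u n s) → ∀ n ∈ S, n ∈ S₀ := by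
    intro hstat n hn
    obtain ⟨t, ht, hne⟩ := hS.exists_ne_zero n hn
    refine Finset.mem_filter.2 ⟨hn, ?_⟩
    rwa [hstat n t ht t₀ (hsub ht₀)] at hne
  by_cases hspan : ∃ a ∈ S₀, ∃ b ∈ S₀, ∃ c ∈ S₀, a ⬝ᵥ (b ⨯₃ c) ≠ 0
  · -- Step 2: the three-dimensional case (§4)
    have hne : S₀.Nonempty := by obtain ⟨a, ha, -⟩ := hspan; exact ⟨a, ha⟩
    obtain ⟨n₁, hn₁, hR⟩ := S₀.exists_max_image (fun s => s ⬝ᵥ s) hne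
    have hBV : ∀ t ∈ Set.Ioo c d, ∃ μ : ℝ, ∀ s ∈ S₀, IsBV μ s (u₀ s t) := by
      intro t ht
      have hspan' := hspan
      obtain ⟨a, ha, b, hb, c', hc', habc⟩ := hspan'
      obtain ⟨μ, hμ⟩ := hS₀.exists_isBV_farthest ht (fun n hn => hgen₀ n hn t ht) hspan hn₁ hR
      exact ⟨μ, hS₀.forall_isBV ht (fun n hn => hgen₀ n hn t ht) ha hb hc' habc hn₁ hR hμ⟩
    have hstat₀ : ∀ n, ∀ t ∈ Set.Ioo c d, ∀ s ∈ Set.Ioo c d, u₀ n t = u₀ n s := by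
      intro n t ht s hs
      apply hS₀.stationary_of_nonInteracting _ n ht hs
      intro r hr a ha b hb _ _
      obtain ⟨μ, hμ⟩ := hBV r hr
      exact (hμ a ha).nonInteracting (hμ b hb) (hS₀.ne_zero_of_mem ha) (hS₀.ne_zero_of_mem hb)
    have hstat : ∀ n, ∀ t ∈ I, ∀ s ∈ I, u n t = u n s := fun n => hglob n c d hcd subset_rfl hstat₀
    refine ⟨hstat, Or.inr ?_⟩
    obtain ⟨μ, hμ⟩ := hBV t₀ ht₀
    have hall : ∀ n ∈ S, IsBV μ n (u n t₀) := by
      intro n hn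
      have hn₀ := hS₀S hstat n hn
      rw [← hu₀_mem n hn₀ t₀]; exact hμ n hn₀
    constructor
    · refine ⟨μ ^ 2, fun n hn => ?_⟩
      rw [(hall n hn).sq_eq (hS.ne_zero_of_mem hn)]
      unfold dotProduct
      refine Finset.sum_congr rfl fun i _ => ?_; ring
    · obtain ⟨n, hn⟩ : S.Nonempty := ⟨n₁, (Finset.mem_filter.1 hn₁).1⟩
      refine ⟨μ, (hall n hn).mu_ne_zero (hS.ne_zero_of_mem hn), fun n hn t ht => ?_⟩
      rw [hstat n t ht t₀ (hsub ht₀)]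
      exact (hall n hn).2.2
  · -- Step 3: the planar case (§3)
    obtain ⟨e, he, hplane⟩ := exists_normal_of_not_spanning hS₀.zero_notMem hspan
    -- a finer generic interval for the horizontal coefficients
    obtain ⟨c', d', hcd', hsub', hgen', hgenh⟩ := hS₀.exists_generic_Ioo (κ := Fin 3 → ℝ) (E := ℂ) S₀
      (fun k z => dot (cplx (e ⨯₃ k)) z) (fun k _ => by unfold dot; fun_prop)
    set t₁ : ℝ := (c' + d') / 2 with ht₁def
    have ht₁ : t₁ ∈ Set.Ioo c' d' := ⟨by rw [ht₁def]; linarith, by rw [ht₁def]; linarith⟩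
    obtain ⟨hS₁, hnz₁, hz₁⟩ := hS₀.restrict hcd' hsub' hgen' ht₁
    -- the support does not change
    have hS₁eq : ∀ n, n ∈ S₀.filter (fun n => u₀ n t₁ ≠ 0) ↔ n ∈ S₀ := by
      intro n
      rw [Finset.mem_filter]
      exact ⟨fun h => h.1, fun h => ⟨h, hgen₀ n h t₁ (hsub' ht₁)⟩⟩
    have hstat₁ := hS₁.planar_stationary (e := e)
      (fun n hn t ht => hnz₁ n hn t ht |> fun h => by simp only [if_pos hn]; exact h) he
      (fun n hn => hplane n ((hS₁eq n).1 hn))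
      (by
        intro n hn
        have hn₀ : n ∈ S₀ := (hS₁eq n).1 hn
        have hk : dot (cplx (e ⨯₃ n)) (cplx (e ⨯₃ n)) ≠ 0 :=
          dot_cplx_self_ne_zero (cross_normal_ne_zero he (hS₀.ne_zero_of_mem hn₀) (hplane n hn₀))
        rcases hgenh (n, n) (Finset.mem_product.2 ⟨hn₀, hn₀⟩) with h | h
        · left; intro t ht
          unfold hcoef; simp only [if_pos hn]; rw [h t ht, zero_div]
        · right; intro t ht
          unfold hcoef; simp only [if_pos hn]; exact div_ne_zero (h t ht) hk)
    -- `u₀` is stationary on `(c', d')`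
    have hstat₀ : ∀ n, ∀ t ∈ Set.Ioo c' d', ∀ s ∈ Set.Ioo c' d', u₀ n t = u₀ n s := by
      intro n t ht s hs
      by_cases hn : n ∈ S₀.filter (fun n => u₀ n t₁ ≠ 0)
      · have := hstat₁ n t ht s hs
        simp only [if_pos hn] at this
        exact this
      · by_cases hn₀ : n ∈ S₀
        · exact absurd ((hS₁eq n).2 hn₀) hn
        · simp only [hu₀def, if_neg hn₀]
    have hstat : ∀ n, ∀ t ∈ I, ∀ s ∈ I, u n t = u n s := fun n => hglob n c' d' hcd' hsub' hstat₀
    refine ⟨hstat, Or.inl ⟨e, he, fun n hn => ?_⟩⟩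
    have := hplane n (hS₀S hstat n hn)
    unfold dotProduct at this
    exact this

end Literature.Analysis.FluidPDE
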